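import Summits.ValiantsHypothesis.ValiantsHypothesis.Theorems.KPlusLogSqLawTropicalBMultiExchange
import Summits.ValiantsHypothesis.ValiantsHypothesis.Theorems.KPlusLogSqLawTropicalBRegisterPairGadget
import Summits.ValiantsHypothesis.ValiantsHypothesis.Theorems.KPlusLogSqLawTropicalBCrossedExchange

/-!
# Route «KPlusLogSqLaw», crux `TropicalB` (stmt-ValiantsHypothesis-19771) — BLOCK RE-MATCHINGS OF A DOMINANT PAIR LIE STRICTLY INSIDE:
# the re-matching engine with arbitrary classes, the LYING INEQUALITY, and «adjacent states of a two-hole register never lie»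

HONEST FRAMING.  Helper toward the registered stubs `stub_tropThin` / `stub_tropFat` of `Cruxes/TropicalB/Lines/birth.lean` (crux
`Summit.ValiantsHypothesis.ValiantsHypothesis.Theses.KPlusLogSqLaw.TropicalB`, item stmt-ValiantsHypothesis-19771, route KPlusLogSqLaw;
cell `pub-symmetroid`, seat val-sym-trop-p5 g15, refuter-adjacent lane, 2026-08-28; `--supports … --as helper`).  STRUCTURE laws about
unique optima (`IsDominant`) of an ARBITRARY design; companions of `…TropicalBTwoSignalLaw` (p624662) and `…TropicalBCrossedExchange`
(p625551).  Nothing here bounds `TropicalB`, and nothing bears on `WeakLifting`, DoorA26 / DoorA34, `MatrixDescartes`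
(stmt-ValiantsHypothesis-18050) or VP ≠ VNP.

* `BlockRematch.rematch` — RE-MATCHING ENGINE with arbitrary classes (val-sym-trop-p4's `RegisterPairFive.hybrid` without the one-class
  restriction): a present term `p`, a column set `G`, a class table `κ` that `p` uses on `G`, and a matching `Y` of `G` onto the rows `p(G)`
  through cells present at their `κ`-class give a present term `q` equal to `p` off `G` whose `G`-cells are those of `Y`, at the `κ`-classes.
* `BlockRematch.lying_inequality` — **THE LYING INEQUALITY.**  Let `P` be dominant at `θ` and `P'` at `θ' > θ`, using a common class table
  `κ` on the columns `G`.  Let `L`, `L'` be matchings of `G` onto the rows `P(G)` resp. `P'(G)`, through cells present at their `κ`-class,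
  which together use EXACTLY THE SAME MULTISET OF CELLS as the `G`-parts `A`, `A'` of `P`, `P'` (`L ∪ L' = A ∪ A'`, `L ∩ L' = A ∩ A'`) and with
  `L ≠ A`.  Then the `κ`-slope of `L` on `G` is STRICTLY LARGER than that of `A`; and if `P`, `P'` agree off `G` and `L' ≠ A`, the
  `κ`-slope of `L'` is strictly larger than that of `A` too (so both lie strictly between the block slopes of `P` and `P'`):
  every non-trivial re-split of the block parts of a dominant pair lies strictly inside.  Proof: the re-matched terms `Q = rematch P L`,
  `Q' = rematch P' L'` repackage `P, P'` column by column, so val-sym-trop-p4's MULTI-EXCHANGE LAW `MultiExchange.prefix_deficit` (t = 2) gives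
  `slope P < slope Q`, and `P`, `Q` agree off `G`.
* `BlockRematch.no_unit_step_lie` — **ADJACENT STATES OF A TWO-HOLE REGISTER NEVER LIE.**  If moreover `P`, `P'` agree off `G`, the block
  cells carry two classes `c₀`, `c₁` with `d c₀ ≠ d c₁`, and `P'` has exactly one more `c₁`-cell on `G` than `P` (consecutive class counts — a
  unit step of a digit), then NO pair `L ≠ A ≠ L'` as above exists: the two re-matchings would have `c₁`-counts summing to `2n + 1` and
  both strictly above `n` (or both strictly below), which is absurd.  With
  `CrossedExchange.crossed_exchange` this says that the exchange of two adjacent states of any single-class two-hole register is of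
  CLOSING type (perfect + double hole) — the branch behind the seat's located «all-CLOSED / all-DOUBLE» LP certificates for every
  double-coupled square and triangle of registers (memo TWO-SIGNAL-g15.md: squares of rotation, path, diagonal-hole, step-2/3 registers, all
  LP-infeasible; 2 × 2 already).
[folklore: LP duality / Abel summation (the multi-exchange law), re-matching of a column block; the packaging («lying inequality») is the cell's]
-/

set_option linter.dupNamespace false
set_option autoImplicit false

namespace Summit.ValiantsHypothesis.ValiantsHypothesis.Theorems.KPlusLogSqLaw

namespace BlockRematch

open Summit.ValiantsHypothesis.ValiantsHypothesis.Theorems.MatrixDescartes.Negative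
open Summit.ValiantsHypothesis.ValiantsHypothesis.Theorems.LacunarySymmetroidMatrixDescartes
open Summit.ValiantsHypothesis.ValiantsHypothesis.Theorems.LacunarySymmetroidMatrixDescartes.TropicalCensus
open Literature.Computability.MetaComplexity.PBij
open Finset

variable {m K : ℕ}

/-! ### The re-matching engine -/

/-- **RE-MATCHING ENGINE** (arbitrary classes).  [folklore; adapted from `RegisterPairFive.hybrid` of val-sym-trop-p4] -/
theorem rematch (ε : Fin m → Fin m → Fin K → ℤ) {p : Equiv.Perm (Fin m) × (Fin m → Fin K)} (hp : termSign ε p ≠ 0)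
    (G : Finset (Fin m)) (κ : Fin m → Fin m → Fin K) {Y : Finset (Fin m × Fin m)} (hY : IsPMatching Y) (hrng : rng Y = G)
    (hdom : dom Y = G.image p.1) (hpres : ∀ e ∈ Y, ε e.1 e.2 (κ e.1 e.2) ≠ 0) :
    ∃ q : Equiv.Perm (Fin m) × (Fin m → Fin K), termSign ε q ≠ 0 ∧ (∀ c, c ∉ G → q.1 c = p.1 c ∧ q.2 c = p.2 c) ∧
      (∀ g ∈ G, (q.1 g, g) ∈ Y ∧ q.2 g = κ (q.1 g) g) := by
  classical
  have huniq : ∀ c, c ∈ G → ∃! e, e ∈ Y ∧ e.2 = c := by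
    intro c hc; obtain ⟨a, ha⟩ := mem_rng.1 (hrng.symm ▸ hc)
    exact ⟨(a, c), ⟨ha, rfl⟩, fun e he => hY e he.1 (a, c) ha (Or.inr he.2)⟩
  let σ' : Fin m → Fin m := fun c => if hc : c ∈ G then (Y.choose (fun e => e.2 = c) (huniq c hc)).1 else p.1 c
  have hσ'G : ∀ c, c ∈ G → (σ' c, c) ∈ Y := by
    intro c hc
    have hspec := Finset.choose_spec (fun e => e.2 = c) Y (huniq c hc)
    have h1 : σ' c = (Y.choose (fun e => e.2 = c) (huniq c hc)).1 := by simp only [σ', dif_pos hc]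
    rw [h1]
    have h2 : ((Y.choose (fun e => e.2 = c) (huniq c hc)).1, c) = Y.choose (fun e => e.2 = c) (huniq c hc) :=
      Prod.ext rfl hspec.2.symm
    rw [h2]; exact hspec.1
  have hσ'nG : ∀ c, c ∉ G → σ' c = p.1 c := fun c hc => by simp only [σ', dif_neg hc]
  have hσ'dom : ∀ c, c ∈ G → σ' c ∈ G.image p.1 := fun c hc => hdom ▸ mem_dom.2 ⟨c, hσ'G c hc⟩
  have hinj : Function.Injective σ' := by
    intro c c' h
    by_cases hc : c ∈ G <;> by_cases hc' : c' ∈ G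
    · have e1 := hσ'G c hc
      have e2 := hσ'G c' hc'
      rw [h] at e1
      exact (Prod.mk.inj (hY _ e1 _ e2 (Or.inl rfl))).2
    · obtain ⟨g, hg, hgc⟩ := Finset.mem_image.1 (hσ'dom c hc)
      rw [h, hσ'nG c' hc'] at hgc; exact absurd (p.1.injective hgc ▸ hg) hc'
    · obtain ⟨g, hg, hgc⟩ := Finset.mem_image.1 (hσ'dom c' hc')
      rw [← h, hσ'nG c hc] at hgc; exact absurd (p.1.injective hgc ▸ hg) hc
    · rw [hσ'nG c hc, hσ'nG c' hc'] at h
      exact p.1.injective h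
  let π : Equiv.Perm (Fin m) := Equiv.ofBijective σ' (Finite.injective_iff_bijective.1 hinj)
  let lam : Fin m → Fin K := fun c => if c ∈ G then κ (σ' c) c else p.2 c
  refine ⟨(π, lam), ?_, ?_, ?_⟩
  · rw [termSign_ne_zero_iff]
    intro c
    by_cases hc : c ∈ G
    · show ε (σ' c) c (lam c) ≠ 0
      simp only [lam, if_pos hc]; exact hpres _ (hσ'G c hc)
    · show ε (σ' c) c (lam c) ≠ 0
      simp only [lam, if_neg hc]; rw [hσ'nG c hc]; exact (termSign_ne_zero_iff ε p).1 hp c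
  · intro c hc
    exact ⟨hσ'nG c hc, by simp only [lam, if_neg hc]⟩
  · intro g hg
    exact ⟨hσ'G g hg, by simp only [lam, if_pos hg]; rfl⟩

/-! ### Membership bookkeeping -/

/-- under `L ∪ L' = A ∪ A'` and `L ∩ L' = A ∩ A'`, every cell is in as many of `L, L'` as of `A, A'`. [elementary] -/
theorem mem_count_eq {α : Type*} [DecidableEq α] {L L' A A' : Finset α} (hU : L ∪ L' = A ∪ A') (hI : L ∩ L' = A ∩ A') (e : α) :
    (if e ∈ L then 1 else 0) + (if e ∈ L' then 1 else 0) = (if e ∈ A then 1 else 0) + (if e ∈ A' then 1 else 0) := by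
  have hU' := Finset.ext_iff.1 hU e
  have hI' := Finset.ext_iff.1 hI e
  simp only [Finset.mem_union, Finset.mem_inter] at hU' hI'
  by_cases h1 : e ∈ L <;> by_cases h2 : e ∈ L' <;> by_cases h3 : e ∈ A <;> by_cases h4 : e ∈ A' <;>
    simp only [h1, h2, h3, h4] at hU' hI' ⊢ <;> tauto

/-- the filter of `range 2` by a predicate, as a sum of two indicators. [elementary] -/
theorem card_filter_range_two (p : ℕ → Prop) [DecidablePred p] :
    ((range 2).filter p).card = (if p 0 then 1 else 0) + (if p 1 then 1 else 0) := by
  have hr2 : range 2 = {0, 1} := by decide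
  rw [hr2, Finset.filter_insert, Finset.filter_singleton]
  by_cases h0 : p 0 <;> by_cases h1 : p 1 <;> simp [h0, h1]

/-! ### The lying inequality -/

/-- **THE LYING INEQUALITY** (every non-trivial re-split of the block parts of a dominant pair lies strictly inside).  See the module
docstring. [folklore: multi-exchange (Abel summation) + re-matching; packaging this cell] -/
theorem lying_inequality (d : Fin K → ℕ) (v ε : Fin m → Fin m → Fin K → ℤ) {θ θ' : ℤ} (hθ : θ < θ')
    {P P' : Equiv.Perm (Fin m) × (Fin m → Fin K)} (hP : IsDominant d v ε θ P) (hP' : IsDominant d v ε θ' P')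
    (G : Finset (Fin m)) (κ : Fin m → Fin m → Fin K)
    (hκ : ∀ g ∈ G, P.2 g = κ (P.1 g) g) (hκ' : ∀ g ∈ G, P'.2 g = κ (P'.1 g) g)
    {L L' : Finset (Fin m × Fin m)} (hL : IsPMatching L) (hL' : IsPMatching L')
    (hrL : rng L = G) (hrL' : rng L' = G) (hdL : dom L = G.image P.1) (hdL' : dom L' = G.image P'.1)
    (hU : L ∪ L' = G.image (fun g => (P.1 g, g)) ∪ G.image (fun g => (P'.1 g, g)))
    (hI : L ∩ L' = G.image (fun g => (P.1 g, g)) ∩ G.image (fun g => (P'.1 g, g)))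
    (hpres : ∀ e ∈ L ∪ L', ε e.1 e.2 (κ e.1 e.2) ≠ 0)
    (hne : L ≠ G.image (fun g => (P.1 g, g))) :
    (∑ g ∈ G, (d (P.2 g) : ℤ) < ∑ e ∈ L, (d (κ e.1 e.2) : ℤ)) ∧
      ((∀ c, c ∉ G → P'.1 c = P.1 c ∧ P'.2 c = P.2 c) → L' ≠ G.image (fun g => (P.1 g, g)) →
        ∑ g ∈ G, (d (P.2 g) : ℤ) < ∑ e ∈ L', (d (κ e.1 e.2) : ℤ)) := by
  classical
  set A := G.image (fun g => (P.1 g, g)) with hA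
  set A' := G.image (fun g => (P'.1 g, g)) with hA'
  -- the re-matched terms
  obtain ⟨Q, hQp, hQoff, hQon⟩ := rematch ε hP.1 G κ hL hrL hdL (fun e he => hpres e (Finset.mem_union_left _ he))
  obtain ⟨Q', hQ'p, hQ'off, hQ'on⟩ := rematch ε hP'.1 G κ hL' hrL' hdL' (fun e he => hpres e (Finset.mem_union_right _ he))
  -- `Q ≠ P` since `L ≠ A`
  have hQne : Q ≠ P := by
    intro h
    apply hne
    -- `L ⊆ A`, both of size `|G|`
    apply Finset.eq_of_subset_of_card_le
    · intro e he
      have hc : e.2 ∈ G := hrL ▸ mem_rng.2 ⟨e.1, he⟩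
      have h1 := (hQon e.2 hc).1
      rw [h] at h1
      have : e = (P.1 e.2, e.2) := hL _ he _ h1 (Or.inr rfl)
      rw [this]; exact Finset.mem_image.2 ⟨e.2, hc, rfl⟩
    · rw [hA, Finset.card_image_of_injective _ (fun g g' hh => (Prod.mk.inj hh).2), ← hL.card_rng, hrL]
  -- the column-wise incidence counts of {P, P'} and {Q, Q'} agree
  let Ps : ℕ → Equiv.Perm (Fin m) × (Fin m → Fin K) := fun j => if j = 0 then P else P'
  let Qs : ℕ → Equiv.Perm (Fin m) × (Fin m → Fin K) := fun j => if j = 0 then Q else Q'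
  let θs : ℕ → ℤ := fun j => if j = 0 then θ else θ'
  -- a term's entry at a block column `b` equals `al` iff its cell at `b` is `(al.1, b)` and `al.2` is that cell's class
  have entry_iff : ∀ (R : Equiv.Perm (Fin m) × (Fin m → Fin K)) (b : Fin m) (al : Fin m × Fin K),
      R.2 b = κ (R.1 b) b → (((R.1 b, R.2 b) = al) ↔ (R.1 b = al.1 ∧ al.2 = κ al.1 b)) := by
    intro R b al hR
    constructor
    · intro h
      have h1 : R.1 b = al.1 := (Prod.mk.inj h).1
      have h2 : R.2 b = al.2 := (Prod.mk.inj h).2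
      exact ⟨h1, by rw [← h2, hR, h1]⟩
    · rintro ⟨h1, h2⟩
      exact Prod.ext h1 (by show R.2 b = al.2; rw [hR, h1, h2])
  -- membership of the cell `(r, b)` in the four matchings, for a block column `b`
  have memA : ∀ b ∈ G, ∀ r, ((r, b) ∈ A ↔ P.1 b = r) := by
    intro b hb r; rw [hA, Finset.mem_image]
    constructor
    · rintro ⟨g, -, hge⟩
      have hgb : g = b := (Prod.mk.inj hge).2
      subst hgb; exact (Prod.mk.inj hge).1
    · intro h; exact ⟨b, hb, by rw [h]⟩
  have memA' : ∀ b ∈ G, ∀ r, ((r, b) ∈ A' ↔ P'.1 b = r) := by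
    intro b hb r; rw [hA', Finset.mem_image]
    constructor
    · rintro ⟨g, -, hge⟩
      have hgb : g = b := (Prod.mk.inj hge).2
      subst hgb; exact (Prod.mk.inj hge).1
    · intro h; exact ⟨b, hb, by rw [h]⟩
  have memL : ∀ b ∈ G, ∀ r, ((r, b) ∈ L ↔ Q.1 b = r) := by
    intro b hb r
    have hQb := (hQon b hb).1
    constructor
    · intro h; exact ((Prod.mk.inj (hL _ hQb _ h (Or.inr rfl))).1)
    · intro h; rw [← h]; exact hQb
  have memL' : ∀ b ∈ G, ∀ r, ((r, b) ∈ L' ↔ Q'.1 b = r) := by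
    intro b hb r
    have hQb := (hQ'on b hb).1
    constructor
    · intro h; exact ((Prod.mk.inj (hL' _ hQb _ h (Or.inr rfl))).1)
    · intro h; rw [← h]; exact hQb
  have hinc : ∀ (b : Fin m) (al : Fin m × Fin K),
      ((range 2).filter fun j => ((Ps j).1 b, (Ps j).2 b) = al).card =
        ((range 2).filter fun j => ((Qs j).1 b, (Qs j).2 b) = al).card := by
    intro b al
    rw [card_filter_range_two, card_filter_range_two]
    simp only [Ps, Qs, if_true, one_ne_zero, if_false]
    by_cases hb : b ∈ G
    · have hmc := mem_count_eq hU hI (al.1, b)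
      simp only [memA b hb, memA' b hb, memL b hb, memL' b hb] at hmc
      simp only [entry_iff P b al (hκ b hb), entry_iff P' b al (hκ' b hb), entry_iff Q b al (hQon b hb).2,
        entry_iff Q' b al (hQ'on b hb).2]
      by_cases hk : al.2 = κ al.1 b
      · simp only [hk, and_true]
        linarith
      · simp only [hk, and_false, if_false]
    · obtain ⟨e1, e2⟩ := hQoff b hb
      obtain ⟨e1', e2'⟩ := hQ'off b hb
      simp only [e1, e2, e1', e2']
  -- swapped indexing of the re-matched pair has the same incidence counts
  let Qs' : ℕ → Equiv.Perm (Fin m) × (Fin m → Fin K) := fun j => if j = 0 then Q' else Q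
  have hinc' : ∀ (b : Fin m) (al : Fin m × Fin K),
      ((range 2).filter fun j => ((Ps j).1 b, (Ps j).2 b) = al).card =
        ((range 2).filter fun j => ((Qs' j).1 b, (Qs' j).2 b) = al).card := by
    intro b al
    rw [hinc b al, card_filter_range_two, card_filter_range_two]
    simp only [Qs, Qs', if_true, one_ne_zero, if_false]
    omega
  have hθs : ∀ i, i + 1 < 2 → θs i ≤ θs (i + 1) := by
    intro i hi; have : i = 0 := by omega
    subst this; simp only [θs]; exact le_of_lt hθ
  have hPs : ∀ j, j < 2 → IsDominant d v ε (θs j) (Ps j) := by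
    intro j hj; rcases Nat.lt_succ_iff.1 hj |> Nat.le_one_iff_eq_zero_or_eq_one.1 with rfl | rfl
    · simpa [Ps, θs] using hP
    · simpa [Ps, θs] using hP'
  -- reading the conclusion of the multi-exchange law: block slope of `P` < block slope of the first re-matched term
  have hsplit : ∀ f : Fin m → ℤ, ∑ i, f i = (∑ i ∈ G, f i) + ∑ i ∈ Gᶜ, f i :=
    fun f => (Finset.sum_add_sum_compl G f).symm
  have read : ∀ (R : Equiv.Perm (Fin m) × (Fin m → Fin K)) (M : Finset (Fin m × Fin m)), IsPMatching M → rng M = G →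
      (∀ c, c ∉ G → R.1 c = P.1 c ∧ R.2 c = P.2 c) → (∀ g ∈ G, (R.1 g, g) ∈ M ∧ R.2 g = κ (R.1 g) g) →
      ∑ b, (d (P.2 b) : ℤ) < ∑ b, (d (R.2 b) : ℤ) →
      ∑ g ∈ G, (d (P.2 g) : ℤ) < ∑ e ∈ M, (d (κ e.1 e.2) : ℤ) := by
    intro R M hM hrM hRoff hRon hlt
    rw [hsplit (fun b => (d (P.2 b) : ℤ)), hsplit (fun b => (d (R.2 b) : ℤ))] at hlt
    have hoff : ∑ i ∈ Gᶜ, (d (R.2 i) : ℤ) = ∑ i ∈ Gᶜ, (d (P.2 i) : ℤ) :=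
      Finset.sum_congr rfl fun i hi => by rw [(hRoff i (Finset.mem_compl.1 hi)).2]
    rw [hoff] at hlt
    have hon : ∑ i ∈ G, (d (R.2 i) : ℤ) = ∑ e ∈ M, (d (κ e.1 e.2) : ℤ) := by
      have hMeq : M = G.image fun g => (R.1 g, g) := by
        ext e
        constructor
        · intro he
          have hc : e.2 ∈ G := hrM ▸ mem_rng.2 ⟨e.1, he⟩
          have : e = (R.1 e.2, e.2) := hM _ he _ (hRon e.2 hc).1 (Or.inr rfl)
          exact Finset.mem_image.2 ⟨e.2, hc, this.symm⟩
        · intro he; obtain ⟨g, hg, rfl⟩ := Finset.mem_image.1 he; exact (hRon g hg).1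
      rw [hMeq, Finset.sum_image (fun g _ g' _ hh => (Prod.mk.inj hh).2)]
      exact Finset.sum_congr rfl fun g hg => by rw [(hRon g hg).2]
    linarith
  constructor
  · obtain ⟨j, hj, hlt⟩ := MultiExchange.prefix_deficit d v ε 2 θs Ps Qs hθs hPs
      (by intro j hj; rcases Nat.lt_succ_iff.1 hj |> Nat.le_one_iff_eq_zero_or_eq_one.1 with rfl | rfl
          · simpa [Qs] using hQp
          · simpa [Qs] using hQ'p)
      ⟨0, by norm_num, by simpa [Ps, Qs] using hQne⟩ hinc
    have hj0 : j = 0 := by omega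
    subst hj0
    simp only [zero_add, Finset.range_one, Finset.sum_singleton, Ps, Qs, if_true] at hlt
    exact read Q L hL hrL hQoff hQon hlt
  · intro hoff hne2
    -- `Q' ≠ P`: their `G`-parts are `L'` and `A`
    have hQ'ne : Q' ≠ P := by
      intro h
      apply hne2
      apply Finset.eq_of_subset_of_card_le
      · intro e he
        have hc : e.2 ∈ G := hrL' ▸ mem_rng.2 ⟨e.1, he⟩
        have h1 := (hQ'on e.2 hc).1
        rw [h] at h1
        have : e = (P.1 e.2, e.2) := hL' _ he _ h1 (Or.inr rfl)
        rw [this]; exact Finset.mem_image.2 ⟨e.2, hc, rfl⟩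
      · rw [Finset.card_image_of_injective _ (fun g g' hh => (Prod.mk.inj hh).2), ← hL'.card_rng, hrL']
    obtain ⟨j, hj, hlt⟩ := MultiExchange.prefix_deficit d v ε 2 θs Ps Qs' hθs hPs
      (by intro j hj; rcases Nat.lt_succ_iff.1 hj |> Nat.le_one_iff_eq_zero_or_eq_one.1 with rfl | rfl
          · simpa [Qs'] using hQ'p
          · simpa [Qs'] using hQp)
      ⟨0, by norm_num, by simpa [Ps, Qs'] using hQ'ne⟩ hinc'
    have hj0 : j = 0 := by omega
    subst hj0
    simp only [zero_add, Finset.range_one, Finset.sum_singleton, Ps, Qs', if_true] at hlt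
    have hQ'offP : ∀ c, c ∉ G → Q'.1 c = P.1 c ∧ Q'.2 c = P.2 c := fun c hc =>
      ⟨(hQ'off c hc).1.trans (hoff c hc).1, (hQ'off c hc).2.trans (hoff c hc).2⟩
    exact read Q' L' hL' hrL' hQ'offP hQ'on hlt

/-! ### Adjacent states never lie -/

/-- **ADJACENT STATES OF A TWO-HOLE REGISTER NEVER LIE.**  See the module docstring: with two block classes `c₀, c₁` of different
exponents and consecutive `c₁`-counts `n`, `n + 1` of `P`, `P'` on `G`, no non-trivial re-split `L, L'` as in `lying_inequality` exists.
[this cell] -/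
theorem no_unit_step_lie (d : Fin K → ℕ) (v ε : Fin m → Fin m → Fin K → ℤ) {θ θ' : ℤ} (hθ : θ < θ')
    {P P' : Equiv.Perm (Fin m) × (Fin m → Fin K)} (hP : IsDominant d v ε θ P) (hP' : IsDominant d v ε θ' P')
    (G : Finset (Fin m)) (κ : Fin m → Fin m → Fin K) (c₀ c₁ : Fin K) (hc : d c₀ ≠ d c₁)
    (hκval : ∀ a b, κ a b = c₀ ∨ κ a b = c₁)
    (hκ : ∀ g ∈ G, P.2 g = κ (P.1 g) g) (hκ' : ∀ g ∈ G, P'.2 g = κ (P'.1 g) g)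
    (hstep : (G.filter fun g => P'.2 g = c₁).card = (G.filter fun g => P.2 g = c₁).card + 1)
    {L L' : Finset (Fin m × Fin m)} (hL : IsPMatching L) (hL' : IsPMatching L')
    (hrL : rng L = G) (hrL' : rng L' = G) (hdL : dom L = G.image P.1) (hdL' : dom L' = G.image P'.1)
    (hU : L ∪ L' = G.image (fun g => (P.1 g, g)) ∪ G.image (fun g => (P'.1 g, g)))
    (hI : L ∩ L' = G.image (fun g => (P.1 g, g)) ∩ G.image (fun g => (P'.1 g, g)))
    (hpres : ∀ e ∈ L ∪ L', ε e.1 e.2 (κ e.1 e.2) ≠ 0)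
    (hoff : ∀ c, c ∉ G → P'.1 c = P.1 c ∧ P'.2 c = P.2 c)
    (hne : L ≠ G.image (fun g => (P.1 g, g))) (hne2 : L' ≠ G.image (fun g => (P.1 g, g))) : False := by
  classical
  set A := G.image (fun g => (P.1 g, g)) with hA
  set A' := G.image (fun g => (P'.1 g, g)) with hA'
  -- both lying inequalities
  obtain ⟨h1, h2imp⟩ := lying_inequality d v ε hθ hP hP' G κ hκ hκ' hL hL' hrL hrL' hdL hdL' hU hI hpres hne
  have h2 := h2imp hoff hne2
  -- express block slopes of `P` as a sum over `A`
  have hPA : ∑ g ∈ G, (d (P.2 g) : ℤ) = ∑ e ∈ A, (d (κ e.1 e.2) : ℤ) := by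
    rw [hA, Finset.sum_image (fun g _ g' _ hh => (Prod.mk.inj hh).2)]
    exact Finset.sum_congr rfl fun g hg => by rw [hκ g hg]
  -- write the `κ`-exponent of a cell as `d c₀ + (d c₁ − d c₀)·[κ = c₁]`
  have hlin : ∀ e : Fin m × Fin m, (d (κ e.1 e.2) : ℤ) = (d c₀ : ℤ) + ((d c₁ : ℤ) - d c₀) * (if κ e.1 e.2 = c₁ then 1 else 0) := by
    intro e
    rcases hκval e.1 e.2 with h | h
    · rw [h]
      by_cases h01 : c₀ = c₁
      · rw [h01]; simp
      · rw [if_neg h01]; ring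
    · rw [h, if_pos rfl]; ring
  have hsumS : ∀ (S : Finset (Fin m × Fin m)),
      ∑ e ∈ S, (d (κ e.1 e.2) : ℤ) = S.card * (d c₀ : ℤ) + ((d c₁ : ℤ) - d c₀) * ((S.filter fun e => κ e.1 e.2 = c₁).card : ℤ) := by
    intro S
    rw [Finset.sum_congr rfl fun e _ => hlin e, Finset.sum_add_distrib, Finset.sum_const, ← Finset.mul_sum]
    simp only [nsmul_eq_mul]
    congr 1
    rw [Finset.sum_boole]
  -- counts of `c₁`-cells and sizes
  have hcnt := CrossedExchange.filter_card_add hU hI (fun e : Fin m × Fin m => κ e.1 e.2 = c₁)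
  have hAG : (A.filter fun e => κ e.1 e.2 = c₁).card = (G.filter fun g => P.2 g = c₁).card := by
    rw [hA, Finset.filter_image, Finset.card_image_of_injective _ (fun g g' hh => (Prod.mk.inj hh).2)]
    congr 1; ext g; simp only [Finset.mem_filter]
    constructor
    · rintro ⟨hg, h⟩; exact ⟨hg, by rw [hκ g hg]; exact h⟩
    · rintro ⟨hg, h⟩; exact ⟨hg, by rw [← hκ g hg]; exact h⟩
  have hAG' : (A'.filter fun e => κ e.1 e.2 = c₁).card = (G.filter fun g => P'.2 g = c₁).card := by
    rw [hA', Finset.filter_image, Finset.card_image_of_injective _ (fun g g' hh => (Prod.mk.inj hh).2)]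
    congr 1; ext g; simp only [Finset.mem_filter]
    constructor
    · rintro ⟨hg, h⟩; exact ⟨hg, by rw [hκ' g hg]; exact h⟩
    · rintro ⟨hg, h⟩; exact ⟨hg, by rw [← hκ' g hg]; exact h⟩
  have cA : A.card = G.card := by rw [hA]; exact Finset.card_image_of_injective _ (fun g g' hh => (Prod.mk.inj hh).2)
  have cL : L.card = G.card := by rw [← hL.card_rng, hrL]
  have cL' : L'.card = G.card := by rw [← hL'.card_rng, hrL']
  rw [hPA, hsumS A, hsumS L, cA, cL] at h1
  rw [hPA, hsumS A, hsumS L', cA, cL'] at h2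
  rw [hAG] at h1 h2
  rw [hAG, hAG', hstep] at hcnt
  -- integer bookkeeping
  set nL := ((L.filter fun e => κ e.1 e.2 = c₁).card : ℕ)
  set nL' := ((L'.filter fun e => κ e.1 e.2 = c₁).card : ℕ)
  set nA := ((G.filter fun g => P.2 g = c₁).card : ℕ)
  have hcntZ : (nL : ℤ) + nL' = nA + (nA + 1) := by exact_mod_cast hcnt
  rcases lt_or_gt_of_ne hc with hlt | hgt
  · have hpos : (0 : ℤ) < (d c₁ : ℤ) - d c₀ := by
      have : (d c₀ : ℤ) < d c₁ := by exact_mod_cast hlt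
      linarith
    have e1 : (nA : ℤ) < nL := by
      by_contra hcon; push Not at hcon
      have := mul_le_mul_of_nonneg_left hcon (le_of_lt hpos); linarith
    have e2 : (nA : ℤ) < nL' := by
      by_contra hcon; push Not at hcon
      have := mul_le_mul_of_nonneg_left hcon (le_of_lt hpos); linarith
    omega
  · have hneg : (d c₁ : ℤ) - d c₀ < 0 := by
      have : (d c₁ : ℤ) < d c₀ := by exact_mod_cast hgt
      linarith
    have e1 : (nL : ℤ) < nA := by
      by_contra hcon; push Not at hcon
      have := mul_le_mul_of_nonpos_left hcon (le_of_lt hneg); linarith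
    have e2 : (nL' : ℤ) < nA := by
      by_contra hcon; push Not at hcon
      have := mul_le_mul_of_nonpos_left hcon (le_of_lt hneg); linarith
    omega

end BlockRematch

end Summit.ValiantsHypothesis.ValiantsHypothesis.Theorems.KPlusLogSqLaw
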